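import Summits.MatrixMultiplication.OmegaCensus.STPP211TFirstReflectF

/-!
# ω-census, `(2,1,1)^k` T-first kernel engine — reflection G: leaf normal form and the theorem through Def. 5.1

HONEST FRAMING (pub-omega census; verbatim): lottery ticket; floor = certified bounds/negative ranges.
Census STRUCTURE bookkeeping of the STPP track (seat pub-omega-stpp-1, gen 38; STRUCTURE row B5, the threshold column
`T1(H) = max {k : (2,1,1)^k ⊆ H}`), not progress on `ω`: small patterns in small groups bound no exponent.

Last reflection file for `STPP211TFirstEngine.lean`.  §15 the leaf NORMAL FORM: re-index the solution along the kernel's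
class order (`orderOK`: code `0` first, pairwise distinct codes, union = the mask of `T`), translate the pairs so that `p₀ = 0`
and `q₀ ∈ [1, n/2]` (swapping all pairs if needed), orient (`ModelD.orient`), and apply `leaf_false`.  §16
**`not_exists_isSTPP_211_of_tfirst`**: if `unitsOK n units`, `runFrontier n K units J roots` and `runRoots n K units roots` are
`true` (kernel decisions; `1 ≤ J ≤ K`, `n ≤ 64`), then `ℤ/n` admits NO STPP family (CKSU Def. 5.1, tree `IsSTPP`) of `K` triples
with `|Aᵢ| = 2`, `|Bᵢ| = |Cᵢ| = 1` — through `exists_isSTPP_211_iff`, the affine transport `ModelD.map_sub` by a unit and a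
canonical member of the affine orbit of the `c`-set (`exists_canon`, `zero_mem_canon`).

References: H. Cohn, R. Kleinberg, B. Szegedy, C. Umans, *Group-theoretic algorithms for matrix multiplication*, FOCS 2005
(arXiv:math/0511460), Def. 5.1.  Desk record: pub-omega HOME `pub-omega-stpp-1-g38/`.
-/

namespace Summit.MatrixMultiplication.OmegaCensus

namespace STPP211T

open STPP211Neg
open Literature.Computability.Complexity (div_mod_block)
open Summit.MatrixMultiplication.OmegaCensus.T1Z2p5 (testBit_lowMask)
open Literature.Barriers.RiemannHypothesis.TuranCheck (beq_true_iff)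
open Literature.Computability.AlgebraicComplexity

/-! ## 15. The leaf normal form -/

section NormalForm

variable {n K : ℕ} [NeZero n] (units : List ℕ)

omit [NeZero n] in
/-- `codesDistinct = true`: the listed codes are pairwise distinct. -/
theorem codesDistinct_true {OC : ℕ} (h : codesDistinct K OC = true) :
    ∀ i j, i < K → j < K → i ≠ j → codeAt OC i ≠ codeAt OC j := by
  -- outer fold over j, inner fold over i
  have outer : ∀ K', (@Nat.rec (fun _ => Bool) true
      (fun j acc => acc && @Nat.rec (fun _ => Bool) true
        (fun i acc2 => acc2 && (Nat.beq i j || !(Nat.beq (codeAt OC i) (codeAt OC j)))) K) K') = true →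
      ∀ i j, i < K → j < K' → i ≠ j → codeAt OC i ≠ codeAt OC j := by
    intro K'
    induction K' with
    | zero => intro _ i j _ hj; omega
    | succ K' ihK =>
        intro hf i j hi hj hij
        have hf' := hf
        simp only [] at hf'
        change (_ && @Nat.rec (fun _ => Bool) true
          (fun i acc2 => acc2 && (Nat.beq i K' || !(Nat.beq (codeAt OC i) (codeAt OC K')))) K) = true at hf'
        rw [Bool.and_eq_true] at hf'
        rcases Nat.lt_succ_iff_lt_or_eq.1 hj with hj | rfl
        · exact ihK hf'.1 i j hi hj hij
        · -- inner fold
          have inner : ∀ K'', (@Nat.rec (fun _ => Bool) true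
              (fun i acc2 => acc2 && (Nat.beq i j || !(Nat.beq (codeAt OC i) (codeAt OC j)))) K'') = true →
              ∀ i, i < K'' → i ≠ j → codeAt OC i ≠ codeAt OC j := by
            intro K''
            induction K'' with
            | zero => intro _ i hi; omega
            | succ K'' ih2 =>
                intro hg i hi hij
                change (_ && (Nat.beq K'' j || !(Nat.beq (codeAt OC K'') (codeAt OC j)))) = true at hg
                rw [Bool.and_eq_true] at hg
                rcases Nat.lt_succ_iff_lt_or_eq.1 hi with hi | rfl
                · exact ih2 hg.1 i hi hij
                · have := hg.2
                  rw [IcosetW.beq_false_of_ne hij, Bool.false_or] at this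
                  intro e; rw [e, Nat.beq_refl] at this; exact Bool.noConfusion this
          exact inner K hf'.2 i hi hij
  exact outer K h

omit [NeZero n] in
/-- The OR-fold of the code bits: its bits are the listed codes. -/
theorem testBit_codeFold (OC : ℕ) : ∀ K' e, (@Nat.rec (fun _ => ℕ) 0
    (fun j acc => force acc fun acc' => Nat.lor acc' (Nat.shiftLeft 1 (codeAt OC j))) K').testBit e = true ↔
      ∃ j < K', codeAt OC j = e := by
  intro K'
  induction K' with
  | zero => intro e; simp
  | succ K' ih =>
      intro e
      change (force (@Nat.rec (fun _ => ℕ) 0 (fun j acc => force acc fun acc' => Nat.lor acc' (Nat.shiftLeft 1 (codeAt OC j))) K')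
        fun acc' => Nat.lor acc' (Nat.shiftLeft 1 (codeAt OC K'))).testBit e = true ↔ _
      rw [force_eq, lor_eq, shiftLeft_eq', Nat.testBit_lor, Nat.one_shiftLeft, Nat.testBit_two_pow, Bool.or_eq_true, ih]
      constructor
      · rintro (⟨j, hj, he⟩ | he)
        · exact ⟨j, by omega, he⟩
        · exact ⟨K', Nat.lt_succ_self _, of_decide_eq_true he⟩
      · rintro ⟨j, hj, he⟩
        rcases Nat.lt_succ_iff_lt_or_eq.1 hj with hj | rfl
        · exact Or.inl ⟨j, hj, he⟩
        · exact Or.inr (by simp [he])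

omit [NeZero n] in
/-- `orderOK = true` unfolded. -/
theorem orderOK_true {PM OC : ℕ} (h : orderOK (mkTC n K units) PM OC = true) :
    codeAt OC 0 = 0 ∧ (∀ i j, i < K → j < K → i ≠ j → codeAt OC i ≠ codeAt OC j) ∧
      ∀ e, PM.testBit e = true ↔ ∃ j < K, codeAt OC j = e := by
  unfold orderOK at h
  rw [Bool.and_eq_true, Bool.and_eq_true, mkTC_K] at h
  refine ⟨beq_true_iff.1 h.1.1, codesDistinct_true h.1.2, fun e => ?_⟩
  rw [← beq_true_iff.1 h.2, testBit_codeFold]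

/-- Swapping all pairs preserves the model. -/
theorem ModelD.swap {G : Type} [AddCommGroup G] {K : ℕ} {p q c : Fin K → G} (hM : ModelD p q c) : ModelD q p c := by
  have same : ∀ i x, InA q p i x ↔ InA p q i x := fun i x => Or.comm
  exact ⟨fun i h => hM.1 i h.symm, fun i l x hil hx hy => hM.2.1 i l x hil ((same i x).1 hx) ((same l x).1 hy),
    fun i j l x y hjl hx hy => hM.2.2 i j l x y hjl ((same i x).1 hx) ((same l y).1 hy)⟩

variable {S : Finset (ZMod n)} {t : ℕ → ℕ}

/-- **THE LEAF NORMAL FORM.** A solution whose `c`-set is the canonical `S` (enumerated by `t`) contradicts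
`tleaf … (Ld t K) = true`. -/
theorem leaf_contra (hn : 1 ≤ n) (hn64 : n ≤ 64) (hC : Canon n K S t) {p q c : Fin K → ZMod n} (hM : ModelD p q c)
    (hcS : ∀ x, x ∈ S ↔ ∃ i, c i = x) (h : tleaf (mkTC n K units) (Ld t K) (maskL (Ld t K)) = true) : False := by
  classical
  have hK := hC.pos
  obtain ⟨h0, hdist, hbits⟩ := orderOK_true units (tleaf_true units h).1
  set OC := OCT n K units (Ld t K)
  -- every listed code is the code of a class
  have hcode : ∀ j : Fin K, ∃ i : Fin K, (c i).val = codeAt OC j.val := by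
    intro j
    have h1 : (maskL (Ld t K)).testBit (codeAt OC j.val) = true := (hbits _).2 ⟨j.val, j.isLt, rfl⟩
    rw [testBit_maskL] at h1
    have h2 := (mem_Ld t K _).1 (of_decide_eq_true h1)
    have h3 := (hC.mem _).2 h2
    unfold codes at h3; rw [Finset.mem_image] at h3
    obtain ⟨x, hx, hxv⟩ := h3
    obtain ⟨i, rfl⟩ := (hcS x).1 hx
    exact ⟨i, hxv⟩
  choose σ hσ using hcode
  have hσinj : Function.Injective σ := by
    intro j j' e
    by_contra hne
    exact hdist j.val j'.val j.isLt j'.isLt (fun h => hne (Fin.ext h)) (by rw [← hσ j, ← hσ j', e])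
  -- re-indexed solution
  have hM1 : ModelD (p ∘ σ) (q ∘ σ) (c ∘ σ) := hM.reindex σ hσinj
  have hD : LeafData n K (Ld t K) OC (c ∘ σ) := by
    refine ⟨fun e he => ?_, fun j => ?_, fun l => (hσ l).symm⟩
    · have h1 : (maskL (Ld t K)).testBit e = true := by rw [testBit_maskL]; simp [he]
      obtain ⟨j, hj, hje⟩ := (hbits e).1 h1
      exact ⟨⟨j, hj⟩, by rw [Function.comp_apply, hσ ⟨j, hj⟩, hje]⟩
    · have h1 : (maskL (Ld t K)).testBit (codeAt OC j.val) = true := (hbits _).2 ⟨j.val, j.isLt, rfl⟩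
      rw [testBit_maskL] at h1
      rw [Function.comp_apply, hσ j]; exact of_decide_eq_true h1
  -- translate the pairs: class 0 gets {0, d} with d.val ≤ n/2
  set i0 : Fin K := ⟨0, hK⟩
  have hpq : (p ∘ σ) i0 ≠ (q ∘ σ) i0 := hM1.1 i0
  -- generic finishing step from a model with p i0 = 0 and 1 ≤ (q i0).val ≤ n/2
  have finish : ∀ (p' q' : Fin K → ZMod n), ModelD p' q' (c ∘ σ) → p' i0 = 0 → 1 ≤ (q' i0).val → (q' i0).val ≤ n / 2 →
      False := by
    intro p' q' hM' hp0 hq1 hq2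
    have hMo := hM'.orient (zmodEnc n)
    have henc : ∀ x : ZMod n, (zmodEnc n).enc x = x.val := fun x => rfl
    simp only [henc] at hMo
    have hcond : (p' i0).val < (q' i0).val := by rw [hp0, ZMod.val_zero]; omega
    refine leaf_false units hn hn64 hK hMo hD (fun l => ?_) ?_ ?_ h
    · have hne : (p' l).val ≠ (q' l).val := fun e => hM'.1 l (ZMod.val_injective n e)
      show (if (p' l).val < (q' l).val then p' l else q' l).val < (if (p' l).val < (q' l).val then q' l else p' l).val
      by_cases hlt : (p' l).val < (q' l).val
      · rw [if_pos hlt, if_pos hlt]; exact hlt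
      · rw [if_neg hlt, if_neg hlt]; omega
    · show (if (p' i0).val < (q' i0).val then p' i0 else q' i0) = 0
      rw [if_pos hcond, hp0]
    · show 1 ≤ (if (p' i0).val < (q' i0).val then q' i0 else p' i0).val ∧
        (if (p' i0).val < (q' i0).val then q' i0 else p' i0).val ≤ n / 2
      rw [if_pos hcond]; exact ⟨hq1, hq2⟩
  set d := (q ∘ σ) i0 - (p ∘ σ) i0 with hd
  have hd0 : d ≠ 0 := fun e => hpq (sub_eq_zero.1 e).symm
  have hdv : 1 ≤ d.val := Nat.pos_of_ne_zero fun e => hd0 ((ZMod.val_eq_zero d).1 e)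
  by_cases hle : d.val ≤ n / 2
  · -- translate by p i0
    have hM2 := hM1.map_sub (AddMonoidHom.id (ZMod n)) (fun _ _ e => e) ((p ∘ σ) i0) 0
    simp only [AddMonoidHom.id_apply, sub_zero] at hM2
    refine finish _ _ hM2 ?_ ?_ ?_
    · simp
    · simpa [hd] using hdv
    · simpa [hd] using hle
  · -- swap and translate by q i0
    have hM2 := (ModelD.swap hM1).map_sub (AddMonoidHom.id (ZMod n)) (fun _ _ e => e) ((q ∘ σ) i0) 0
    simp only [AddMonoidHom.id_apply, sub_zero] at hM2
    have hneg : (p ∘ σ) i0 - (q ∘ σ) i0 = -d := by rw [hd]; abel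
    have hnv : (-d).val = n - d.val := by rw [ZMod.neg_val, if_neg hd0]
    have hdn : d.val < n := ZMod.val_lt d
    refine finish _ _ hM2 ?_ ?_ ?_
    · simp
    · show 1 ≤ ((p ∘ σ) i0 - (q ∘ σ) i0).val
      rw [hneg, hnv]; omega
    · show ((p ∘ σ) i0 - (q ∘ σ) i0).val ≤ n / 2
      rw [hneg, hnv]; omega

end NormalForm

/-! ## 16. The theorem through Def. 5.1 -/

section Final

variable {n : ℕ} [NeZero n]

omit [NeZero n] in
/-- `unitsOK = true`: `2 ≤ n` and every listed `u` is coprime to `n`. -/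
theorem unitsOK_true {units : List ℕ} (h : unitsOK n units = true) : 2 ≤ n ∧ ∀ u ∈ units, Nat.Coprime u n := by
  unfold unitsOK at h
  rw [Bool.and_eq_true] at h
  refine ⟨by have := h.1; simpa using this, ?_⟩
  have key : ∀ us : List ℕ, (@List.rec ℕ (fun _ => Bool) true (fun u _ ih => Nat.beq (Nat.gcd u n) 1 && ih) us) = true →
      ∀ u ∈ us, Nat.Coprime u n := by
    intro us
    induction us with
    | nil => intro _ u hu; simp at hu
    | cons u us ih =>
        intro hh v hv
        change (Nat.beq (Nat.gcd u n) 1 && @List.rec ℕ (fun _ => Bool) true (fun u _ ih => Nat.beq (Nat.gcd u n) 1 && ih) us) = true at hh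
        rw [Bool.and_eq_true] at hh
        rcases List.mem_cons.1 hv with rfl | hv
        · exact beq_true_iff.1 hh.1
        · exact ih hh.2 v hv
  exact key units h.2

/-- **THE T-FIRST KERNEL CERTIFICATE, REFLECTED THROUGH DEF. 5.1.**  If the listed units are units of `ℤ/n`
(`unitsOK`), the canonical-prefix frontier of depth `J` is contained in `roots` (`runFrontier`) and the T-first search
below every root answers `true` (`runRoots`) — three `decide +kernel` evaluations — then `ℤ/n` admits NO STPP family
(CKSU Def. 5.1, tree `IsSTPP`) of `K` triples with `|Aᵢ| = 2`, `|Bᵢ| = |Cᵢ| = 1`.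
[cite: CohnKleinbergSzegedyUmans2005, Def. 5.1] -/
theorem not_exists_isSTPP_211_of_tfirst (K J : ℕ) (units : List ℕ) (roots : List (List ℕ)) (hn64 : n ≤ 64)
    (hJ : 1 ≤ J) (hJK : J ≤ K) (hu : unitsOK n units = true) (hf : runFrontier n K units J roots = true)
    (hs : runRoots n K units roots = true) :
    ¬ ∃ A B C : Fin K → Finset (ZMod n), IsSTPP A B C ∧
      ∀ i, (A i).card = 2 ∧ (B i).card = 1 ∧ (C i).card = 1 := by
  classical
  obtain ⟨hn2, hcop⟩ := unitsOK_true hu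
  unfold runFrontier at hf
  unfold runRoots at hs
  rw [withTC_eq] at hf hs
  change frontierOK (mkTC n K units) J roots = true at hf
  change tsearchRoots (mkTC n K units) roots = true at hs
  rw [exists_isSTPP_211_iff]
  rintro ⟨p, q, c, hpq, hDj, hX⟩
  have hM : ModelD p q c := modelD_of_finsetForm hpq hDj hX
  have hK : 1 ≤ K := by omega
  -- the c-set and a canonical member of its orbit
  set S0 : Finset (ZMod n) := Finset.univ.image c with hS0
  obtain ⟨w, b, hcan⟩ := exists_canon S0
  set S := aff (w : ZMod n) b S0 with hS
  -- transport the solution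
  have hwinj : Function.Injective (AddMonoidHom.mulLeft (w : ZMod n)) := fun x y e => by
    simpa using congrArg (fun z => ((w⁻¹ : (ZMod n)ˣ) : ZMod n) * z) e
  have hM1 := hM.map_sub (AddMonoidHom.mulLeft (w : ZMod n)) hwinj 0 b
  simp only [AddMonoidHom.coe_mulLeft, sub_zero] at hM1
  set c1 : Fin K → ZMod n := fun i => (w : ZMod n) * (c i - b) with hc1
  have hcS : ∀ x, x ∈ S ↔ ∃ i, c1 i = x := by
    intro x
    rw [hS, aff, Finset.mem_image]
    constructor
    · rintro ⟨y, hy, rfl⟩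
      rw [hS0, Finset.mem_image] at hy
      obtain ⟨i, -, rfl⟩ := hy
      exact ⟨i, rfl⟩
    · rintro ⟨i, rfl⟩
      exact ⟨c i, by rw [hS0]; exact Finset.mem_image_of_mem _ (Finset.mem_univ _), rfl⟩
  have hc1inj : Function.Injective c1 := fun i j e => by
    by_contra hij; exact hM1.c_ne hij e
  have hcard : (codes S).card = K := by
    unfold codes
    rw [Finset.card_image_of_injective _ (ZMod.val_injective n)]
    have : S = Finset.univ.image c1 := by
      ext x; rw [hcS, Finset.mem_image]; simp [eq_comm]
    rw [this, Finset.card_image_of_injective _ hc1inj, Finset.card_univ, Fintype.card_fin]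
  have h0S : (0 : ZMod n) ∈ S := zero_mem_canon ⟨c1 ⟨0, hK⟩, (hcS _).2 ⟨_, rfl⟩⟩ hcan
  -- the increasing enumeration of the codes
  let emb := (codes S).orderEmbOfFin hcard
  let t : ℕ → ℕ := fun i => if h : i < K then emb ⟨i, h⟩ else 0
  have ht : ∀ i (h : i < K), t i = emb ⟨i, h⟩ := fun i h => by simp [t, h]
  have hC : Canon n K S t := by
    refine ⟨hcan, fun e => ?_, fun i i' hii' hi' => ?_, ?_, hK⟩
    · constructor
      · intro he
        have : e ∈ Set.range emb := by rw [Finset.range_orderEmbOfFin]; exact he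
        obtain ⟨⟨i, hi⟩, rfl⟩ := this
        exact ⟨i, hi, (ht i hi).symm⟩
      · rintro ⟨i, hi, rfl⟩
        rw [ht i hi]; exact Finset.orderEmbOfFin_mem _ _ _
    · rw [ht i (by omega), ht i' hi']
      exact emb.strictMono (Fin.mk_lt_mk.2 hii')
    · rw [ht 0 hK]
      have hmin : emb ⟨0, hK⟩ ≤ 0 := by
        have h0 : (0 : ℕ) ∈ codes S := by
          unfold codes; rw [Finset.mem_image]; exact ⟨0, h0S, ZMod.val_zero⟩
        have : (0 : ℕ) ∈ Set.range emb := by rw [Finset.range_orderEmbOfFin]; exact h0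
        obtain ⟨⟨i, hi⟩, hi0⟩ := this
        have hle := emb.monotone (Fin.mk_le_mk.2 (Nat.zero_le i) : (⟨0, hK⟩ : Fin K) ≤ ⟨i, hi⟩)
        rw [hi0] at hle
        exact hle
      omega
  -- the T-phase reaches the leaf of S, and the leaf cannot refute the transported solution
  have hmem := frontier_mem units hcop hC hJ hJK hf
  have hleaf := tleaf_of_roots units hcop hC hJ hJK hmem hs
  exact leaf_contra units (by omega) hn64 hC hM1 hcS hleaf

end Final

end STPP211T

end Summit.MatrixMultiplication.OmegaCensus
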